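import Literature.AnabelianGeometry.EtaleTheta.ThetaRigidityLevels
import Literature.AnabelianGeometry.EtaleTheta.Discharge.Sec2Cor218LevelsOfModel
import Literature.AnabelianGeometry.SemiGraphs.WitnessIwahoriGroup
import HarnessLib

/-!
# [EtTh] Cor. 2.18 (iii), first part (`Ker(Π• ↠ Π•_Y)` = the union of the centralisers of the OPEN subgroups)
# HOLDS UNCONDITIONALLY at a pro-`2` Iwahori toy — FACT rows F-0623 `RigidData.Cor218_iii_quotient` /
# F-0637 `ThetaEnvData.Cor218_iii_quotient` instance-PROVED at a datum with a genuinely profinite `Π^tp_Y`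
# (proof-only)

S. Mochizuki, *The Étale Theta Function …* [EtTh], Publ. RIMS **45** (2009), §2, Prop. 2.11 (ii) p. 44 (the
kernel of `Π[μ_N] ↠ Π` "is the union of the centralizers of the open subgroups"), Cor. 2.18 (iii) p. 61 ("the
algorithm for constructing the quotient `Π• ↠ Π•_Y` is precisely the content of Proposition 2.11, (ii)") (locators
`p.N` = PDF pages; bib key `MochizukiEtTh2009`).

PROOF-ONLY (no `def`, no instance, no new named fact; cell `abc-iut`, seat abc-iut-w6-d089).  abc-iut-w5-d175
showed the universal closure of F-0623 is kernel-false (DISCRETE toys: `{1}` is open, so every element centralises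
an open subgroup); lane C2 (abc-iut-L2-d1 / f-150) proves the row at the [EtTh] §1 model CONDITIONALLY on the
temp-slimness of `Π^tp` (`ThetaEnvData.cor218_iii_quotient_of_slimY` / `…_of_tempSlim`).  Here an UNCONDITIONAL
instance where the topology does the work:

* the datum (built inside the proof): `Π^tp_X := P × ℤ` with `P = ℤ_2 ⋊ (1 + 2ℤ_2)` the pro-`2` Iwahori-type group of
  abc-iut-w6-d089 (gen 0)'s `SemiGraphs/WitnessIwahoriGroup.lean` (`Iw 2`, coordinates `(a, s)`, `u = 1 + 2s`) and
  `ℤ` discrete; `Π^tp_Y := P × 0`; `Π^tp_Ÿ := {s ≡ 0 mod 2} × 0` (index `2`); `G_K := 1`; `μ_2`; `(l·Δ_Θ) := Π^tp_Ÿ`,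
  `Ker(Π ↠ Π^Θ) := {s ≡ 0 mod 4} × 0`, `thetaMod = η₀ : (a, s) ↦ s/2 mod 2` (read off `s mod 4 ∈ {0, 2}`; locally
  constant because reduction `ℤ_2 → ℤ/4` has open fibres);
* **`exists_rigidData_cor218_iii_quotient`** — at it: `{1} ⊆ Π^tp_X` is NOT open (so the discrete refutation
  mechanism is absent), `Cor218_iii_quotient` HOLDS (by L2's `cor218_iii_quotient_of_slimY` from gen 0's
  `Iw.centralizer_eq_bot_of_isOpen`: `P` is slim), and `Cor218_iii_PiX` FAILS (the `ℤ`-factor centralises `Π^tp_Y` —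
  an unconditional instance of F-0622 needs a `Π^tp_Y` with an outer automorphism of infinite order; not claimed);
* `ThetaEnvData.exists_cor218_iii_quotient` — the `ThetaEnvData`-level row F-0637 (same datum, `Iff.rfl` bridge).

HONEST FRAMING: statements about the cell's own typing at one explicit toy; print's Cor. 2.18 (iii) concerns the
tempered fundamental group of a specific curve and is neither proved nor refuted here; nothing bears on
[IUTchIII] Cor. 3.12; no side taken; typed ≠ proved.
-/

noncomputable section

namespace Literature.AnabelianGeometry.EtaleTheta

namespace RigidData

open Literature.AnabelianGeometry.SemiGraphs

/-- **F-0623 at the pro-`2` Iwahori toy.**  There is a `RigidData 2 1` whose `Π^tp_X = (ℤ_2 ⋊ (1+2ℤ_2)) × ℤ` is NOT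
discrete, at which `Cor218_iii_quotient` (`Ker(Π• ↠ Π•_Y)` = union of centralisers of open subgroups) HOLDS and
`Cor218_iii_PiX` (temp-slimness of `Π_Y ⊆ Π_X`) FAILS. [cite: MochizukiEtTh2009, Cor 2.18(iii) p.61] -/
theorem exists_rigidData_cor218_iii_quotient :
    ∃ R : RigidData.{0} 2 1, ¬ IsOpen ({1} : Set R.PiX) ∧
      Literature.AnabelianGeometry.EtaleTheta.RigidData.Cor218_iii_quotient R ∧
      ¬ Literature.AnabelianGeometry.EtaleTheta.RigidData.Cor218_iii_PiX R := by
  -- the finite bookkeeping in `ℤ/4`, `ℤ/2` (closed goals, decided by the kernel)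
  have hκ : ∀ r : ZMod (2 ^ 2), ZMod.castHom (dvd_pow_self 2 two_ne_zero) (ZMod 2) r = 0 ↔ r = 0 ∨ r = 2 := by
    decide
  have hκ2 : ZMod.castHom (dvd_pow_self 2 two_ne_zero) (ZMod 2) (2 : ZMod (2 ^ 2)) = 0 := by decide
  have key : ∀ r r' : ZMod (2 ^ 2), (r = 0 ∨ r = 2) → (r' = 0 ∨ r' = 2) →
      (if r + r' + 2 * r * r' = 0 then (1 : Multiplicative (ZMod 2)) else Multiplicative.ofAdd 1) =
        (if r = 0 then (1 : Multiplicative (ZMod 2)) else Multiplicative.ofAdd 1) *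
          (if r' = 0 then (1 : Multiplicative (ZMod 2)) else Multiplicative.ofAdd 1) := by decide
  have hcases : ∀ t : Multiplicative (ZMod 2), t = 1 ∨ t = Multiplicative.ofAdd 1 := by decide
  have hone : (Multiplicative.ofAdd (1 : ZMod 2)) ≠ 1 := by decide
  have hsq : ∀ t : Multiplicative (ZMod 2), t * t = 1 := by decide
  haveI hp : Fact (Nat.Prime 2) := ⟨Nat.prime_two⟩
  -- the group `Π := P × ℤ`, `P = Iw 2`
  let P : Type := Iw 2 × Multiplicative ℤ
  let PiY : Subgroup P := (MonoidHom.snd (Iw 2) (Multiplicative ℤ)).ker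
  have mem_PiY : ∀ x : P, x ∈ PiY ↔ x.2 = 1 := fun x => Iff.rfl
  -- reduction `s mod 4` and `s mod 2`
  let ρ : ℤ_[2] →+* ZMod (2 ^ 2) := PadicInt.toZModPow 2
  let κ : ZMod (2 ^ 2) →+* ZMod 2 := ZMod.castHom (dvd_pow_self 2 two_ne_zero) (ZMod 2)
  have hκ2' : κ 2 = 0 := hκ2
  have hκ' : ∀ r, κ r = 0 ↔ r = 0 ∨ r = 2 := hκ
  have hρ1 : ρ (1 : P).1.s = 0 := by rw [Prod.fst_one, Iw.one_s, map_zero]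
  have hρs : ∀ x y : P, ρ (x * y).1.s = ρ x.1.s + ρ y.1.s + 2 * ρ x.1.s * ρ y.1.s := by
    intro x y
    rw [Prod.fst_mul, Iw.mul_s, map_add, map_add, map_mul, map_mul, map_natCast, Nat.cast_ofNat]
  -- `ρ` is locally constant (fibres are closed balls of radius `1/4`, open in the ultrametric `ℤ_2`)
  have hρlc : IsLocallyConstant (ρ : ℤ_[2] → ZMod (2 ^ 2)) := by
    refine (IsLocallyConstant.iff_isOpen_fiber).mpr fun c => ?_
    rw [isOpen_iff_mem_nhds]
    intro x hx
    have hx' : ρ x = c := hx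
    have hpos : (0 : ℝ) < (2 : ℝ) ^ (-(2 : ℤ)) := by positivity
    refine Filter.mem_of_superset (Metric.ball_mem_nhds x hpos) fun y hy => ?_
    change ρ y ∈ ({c} : Set (ZMod (2 ^ 2)))
    rw [Set.mem_singleton_iff, ← hx', ← sub_eq_zero, ← map_sub, ← RingHom.mem_ker]
    change y - x ∈ RingHom.ker (PadicInt.toZModPow 2)
    rw [PadicInt.ker_toZModPow, ← PadicInt.norm_le_pow_iff_mem_span_pow, ← dist_eq_norm]
    exact_mod_cast (Metric.mem_ball.mp hy).le
  have hρPlc : IsLocallyConstant fun x : P => ρ x.1.s :=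
    hρlc.comp_continuous (Iw.continuous_s.comp continuous_fst)
  -- `L : (x, n) ↦ s mod 2`, a homomorphism on all of `Π`
  let L : P →* Multiplicative (ZMod 2) :=
    { toFun := fun x => Multiplicative.ofAdd (κ (ρ x.1.s))
      map_one' := by
        change Multiplicative.ofAdd (κ (ρ (1 : P).1.s)) = 1
        rw [hρ1, map_zero, ofAdd_zero]
      map_mul' := fun x y => by
        change Multiplicative.ofAdd (κ (ρ (x * y).1.s)) =
          Multiplicative.ofAdd (κ (ρ x.1.s)) * Multiplicative.ofAdd (κ (ρ y.1.s))
        rw [hρs, κ.map_add, κ.map_add, κ.map_mul, κ.map_mul, hκ2', zero_mul, zero_mul, add_zero, ofAdd_add] }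
  let PiYdd : Subgroup P := L.ker ⊓ PiY
  have mem_PiYdd : ∀ x : P, x ∈ PiYdd ↔ κ (ρ x.1.s) = 0 ∧ x.2 = 1 := fun x => by
    change (L x = 1 ∧ x ∈ PiY) ↔ _
    rw [mem_PiY]
    exact Iff.rfl
  haveI hPiYdd_normal : PiYdd.Normal := inferInstance
  -- conjugation preserves the `s`-coordinate
  have hconj_s : ∀ g x : P, (g * x * g⁻¹).1.s = x.1.s := fun g x => by
    rw [Prod.fst_mul, Prod.fst_mul, Prod.fst_inv]
    exact (Iw.conj_coords g.1 x.1).1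
  -- `θ : (a, s) ↦ s/2 mod 2` on `Π_Ÿ`
  let θf : P → Multiplicative (ZMod 2) := fun x =>
    if ρ x.1.s = 0 then (1 : Multiplicative (ZMod 2)) else Multiplicative.ofAdd 1
  have θf_mul : ∀ x y : P, x ∈ PiYdd → y ∈ PiYdd → θf (x * y) = θf x * θf y := by
    intro x y hx hy
    change (if ρ (x * y).1.s = 0 then _ else _) = (if ρ x.1.s = 0 then _ else _) * (if ρ y.1.s = 0 then _ else _)
    rw [hρs]
    exact key _ _ ((hκ' _).mp ((mem_PiYdd x).mp hx).1) ((hκ' _).mp ((mem_PiYdd y).mp hy).1)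
  have θf_lc : IsLocallyConstant θf :=
    hρPlc.comp fun r => if r = 0 then (1 : Multiplicative (ZMod 2)) else Multiplicative.ofAdd 1
  -- `Ker(Π ↠ Π^Θ) := {s ≡ 0 mod 4} × 0`
  let K4 : Subgroup P :=
    { carrier := {x | ρ x.1.s = 0 ∧ x.2 = 1}
      mul_mem' := fun {x y} hx hy => ⟨by
        change ρ (x * y).1.s = 0
        rw [hρs, hx.1, hy.1]; decide, by
        change (x * y).2 = 1; rw [Prod.snd_mul, hx.2, hy.2, mul_one]⟩
      one_mem' := ⟨hρ1, rfl⟩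
      inv_mem' := fun {x} hx => ⟨by
        have h := hρs x⁻¹ x
        rw [inv_mul_cancel, hρ1, hx.1, add_zero, mul_zero, add_zero] at h
        exact h.symm, by change x⁻¹.2 = 1; rw [Prod.snd_inv, hx.2, inv_one]⟩ }
  have mem_K4 : ∀ x : P, x ∈ K4 ↔ ρ x.1.s = 0 ∧ x.2 = 1 := fun x => Iff.rfl
  have hK4_le : K4 ≤ PiYdd := fun x hx => (mem_PiYdd x).mpr ⟨by rw [hx.1, map_zero], hx.2⟩
  have hK4_normal : K4.Normal := ⟨fun x hx g => (mem_K4 _).mpr ⟨by rw [hconj_s]; exact hx.1, by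
    change (g * x * g⁻¹).2 = 1
    rw [Prod.snd_mul, Prod.snd_mul, Prod.snd_inv, hx.2, mul_one, mul_inv_cancel]⟩⟩
  -- distinguished elements: `x₁ = ((0, 1), 0)` (odd `s`), `x₂ = ((0, 2), 0)` (`s/2` odd)
  let x₁ : P := (⟨0, 1⟩, 1)
  let x₂ : P := (⟨0, 2⟩, 1)
  have hx₁ : L x₁ = Multiplicative.ofAdd 1 := by
    change Multiplicative.ofAdd (κ (ρ 1)) = _
    rw [map_one, map_one]
  have hx₂ρ : ρ x₂.1.s = 2 := by
    change ρ (2 : ℤ_[2]) = 2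
    rw [map_ofNat]
  have hx₂ : x₂ ∈ PiYdd := (mem_PiYdd _).mpr ⟨by rw [hx₂ρ, hκ2], rfl⟩
  have index_PiYdd : (PiYdd.subgroupOf PiY).index = 2 := by
    change PiYdd.relIndex PiY = 2
    rw [Subgroup.inf_relIndex_right, Subgroup.relIndex_ker]
    have hmap : PiY.map L = ⊤ := by
      refine top_le_iff.mp fun t _ => ?_
      rcases hcases t with rfl | rfl
      · exact ⟨1, PiY.one_mem, map_one L⟩
      · exact ⟨x₁, rfl, hx₁⟩
    rw [hmap, Subgroup.card_top, Nat.card_eq_fintype_card]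
    rfl
  let η₀ : PiYdd → Multiplicative (ZMod 2) := fun y => θf y
  let R : RigidData.{0} 2 1 :=
    { PiX := P
      G := PUnit
      aug := 1
      aug_surjective := fun _ => ⟨1, Subsingleton.elim _ _⟩
      PiY := PiY
      PiY_normal := MonoidHom.normal_ker _
      PiY_open := by
        change IsOpen ((fun x : P => x.2) ⁻¹' {1})
        exact (isOpen_discrete _).preimage continuous_snd
      galYX := QuotientGroup.quotientKerEquivOfSurjective _ fun z => ⟨(1, z), rfl⟩
      PiYdd := PiYdd
      PiYdd_le := inf_le_right
      PiYdd_normal := hPiYdd_normal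
      PiYdd_open := by
        have h1 : IsOpen ((fun x : P => κ (ρ x.1.s)) ⁻¹' {0}) := (hρPlc.comp fun r => κ r).isOpen_fiber 0
        have h2 : IsOpen ((fun x : P => x.2) ⁻¹' {1}) := (isOpen_discrete _).preimage continuous_snd
        convert h1.inter h2 using 1
        ext x
        exact mem_PiYdd x
      index_PiYdd := index_PiYdd
      mu := Multiplicative (ZMod 2)
      mu_cyclic := inferInstance
      card_mu := rfl
      chi := 1
      chi_ker_open := by
        rw [MonoidHom.one_comp, MonoidHom.ker_one, Subgroup.coe_top]
        exact isOpen_univ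
      thetaCocycles := {η₀}
      thetaCocycles_nonempty := Set.singleton_nonempty _
      isCocycle := by
        rintro η hη
        rw [Set.mem_singleton_iff] at hη
        subst hη
        intro x y
        change θf ((x : P) * y) = θf x * θf y
        exact θf_mul x y x.2 y.2
      locallyConstant := by
        rintro η hη
        rw [Set.mem_singleton_iff] at hη
        subst hη
        exact θf_lc.comp_continuous continuous_subtype_val
      mul_coboundary_mem := by
        rintro η hη c
        rw [Set.mem_singleton_iff] at hη ⊢
        subst hη
        funext x
        simp [CycEnvelope.coboundary]
      thetaKer := K4
      thetaKer_normal := hK4_normal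
      thetaKer_le := by rw [MonoidHom.ker_one]; exact le_inf hK4_le le_top
      lDeltaTheta := PiYdd
      thetaKer_le_lDeltaTheta := hK4_le
      lDeltaTheta_le := by rw [MonoidHom.ker_one]; exact le_inf le_rfl le_top
      lDeltaTheta_normal := hPiYdd_normal
      thetaMod := MonoidHom.mk' (fun g => θf g) fun g h => θf_mul g h g.2 h.2
      thetaMod_surjective := by
        intro m
        rcases hcases m with rfl | rfl
        · exact ⟨1, map_one _⟩
        · refine ⟨⟨x₂, hx₂⟩, ?_⟩
          change (if ρ x₂.1.s = 0 then (1 : Multiplicative (ZMod 2)) else Multiplicative.ofAdd 1) = _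
          rw [hx₂ρ, if_neg (by decide)]
      thetaMod_ker := by
        rintro ⟨g, hg⟩
        change (if ρ g.1.s = 0 then (1 : Multiplicative (ZMod 2)) else Multiplicative.ofAdd 1) = 1 ↔ _
        constructor
        · intro h1
          have hρg : ρ g.1.s = 0 := by
            by_contra hne
            rw [if_neg hne] at h1
            exact absurd h1 hone
          exact ⟨g, (mem_K4 g).mpr ⟨hρg, ((mem_PiYdd g).mp hg).2⟩, 1, by simp⟩
        · rintro ⟨k, hk, ⟨h, hh⟩, hkh⟩
          have hkh' : g = k * (h * h) := by simpa [pow_two] using hkh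
          have hρk : ρ k.1.s = 0 := ((mem_K4 k).mp hk).1
          change θf g = 1
          rw [hkh', θf_mul k (h * h) (hK4_le hk) (PiYdd.mul_mem hh hh), θf_mul h h hh hh, hsq, mul_one]
          exact if_pos hρk
      thetaMod_conj := fun x g => by
        change (if ρ (x * (g : P) * x⁻¹).1.s = 0 then (1 : Multiplicative (ZMod 2)) else Multiplicative.ofAdd 1) =
          (1 : MulAut (Multiplicative (ZMod 2))) (if ρ (g : P).1.s = 0 then 1 else Multiplicative.ofAdd 1)
        rw [hconj_s, MulAut.one_apply]
      cocycle_thetaKer := by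
        rintro η hη y hy
        have h1 : η = η₀ := hη
        subst h1
        change (if ρ (y : P).1.s = 0 then (1 : Multiplicative (ZMod 2)) else Multiplicative.ofAdd 1) = 1
        rw [if_pos ((mem_K4 _).mp hy).1]
      cocycle_lDeltaTheta := by
        rintro η hη y hy
        have h1 : η = η₀ := hη
        subst h1
        rfl
      cuspY := fun _ => ∅
      cuspX := fun _ => ∅
      cuspX_neg := fun _ => rfl
      augYdd_surjective := fun _ => ⟨1, Subsingleton.elim _ _⟩
      thetaSections_conj := by
        intro η η' hη hη'
        have h1 : η = η₀ := hη
        have h2 : η' = η₀ := hη'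
        subst h1 h2
        exact ThetaEnvData.IsKLConjugate.base }
  let T : ThetaEnvData.{0} 2 := R.toThetaEnvData
  refine ⟨R, fun hopen => ?_, ?_, fun h => ?_⟩
  · -- `{1}` is not open: otherwise `P = Iw 2` (compact, infinite) would be discrete
    have hι : Continuous fun x : Iw 2 => ((x, 1) : P) := continuous_id.prodMk continuous_const
    have h1 : IsOpen ({1} : Set (Iw 2)) := by
      convert hopen.preimage hι using 1
      ext x
      simp only [Set.mem_singleton_iff, Set.mem_preimage, Prod.mk_eq_one, and_true]
    haveI : DiscreteTopology (Iw 2) := discreteTopology_of_isOpen_singleton_one h1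
    haveI : Infinite (Iw 2) := Infinite.of_injective (Iw.bHom (p := 2) 0) (Iw.bHom_injective 0)
    haveI : Finite (Iw 2) := finite_of_compact_of_discrete
    exact not_finite (Iw 2)
  · -- Cor. 2.18 (iii), quotient part: `Π_Y ≅ P` is slim
    refine T.cor218_iii_quotient_of_slimY fun U hU z hz => ?_
    let ι : Iw 2 →* T.PiY :=
      { toFun := fun x => ⟨(x, 1), rfl⟩
        map_one' := rfl
        map_mul' := fun _ _ => rfl }
    have hιc : Continuous ι := (continuous_id.prodMk continuous_const).subtype_mk _
    have hU' : IsOpen ((U.comap ι : Subgroup (Iw 2)) : Set (Iw 2)) := by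
      rw [Subgroup.coe_comap]
      exact hU.preimage hιc
    have hz0 : (z : P).1 ∈ Subgroup.centralizer ((U.comap ι : Subgroup (Iw 2)) : Set (Iw 2)) := by
      rw [Subgroup.mem_centralizer_iff]
      intro u hu
      exact (congrArg (fun w : T.PiY => (w : P).1) (hz (ι u) hu)).symm
    rw [Iw.centralizer_eq_bot_of_isOpen _ hU', Subgroup.mem_bot] at hz0
    apply Subtype.ext
    exact Prod.ext hz0 z.2
  · -- but `Π_Y ⊆ Π_X` is NOT temp-slim: the `ℤ`-factor centralises `Π_Y`
    let g : P := (1, Multiplicative.ofAdd 1)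
    have hg : g = 1 := h g fun y => by
      have hy : (y : P).2 = 1 := y.2
      refine Prod.ext ?_ ?_
      · change (1 : Iw 2) * (y : P).1 * 1⁻¹ = (y : P).1
        rw [one_mul, inv_one, mul_one]
      · change Multiplicative.ofAdd (1 : ℤ) * (y : P).2 * (Multiplicative.ofAdd (1 : ℤ))⁻¹ = (y : P).2
        rw [hy, mul_one, mul_inv_cancel]
    have h2 := congrArg (fun x : P => Multiplicative.toAdd x.2) hg
    simp [g] at h2

end RigidData

/-- **F-0637 (the `ThetaEnvData`-level row) instance-PROVED** at the same pro-`2` Iwahori toy, with non-discrete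
`Π^tp_X`. [cite: MochizukiEtTh2009, Cor 2.18(iii) p.61] -/
theorem ThetaEnvData.exists_cor218_iii_quotient :
    ∃ T : ThetaEnvData.{0} 2, ¬ IsOpen ({1} : Set T.PiX) ∧
      Literature.AnabelianGeometry.EtaleTheta.ThetaEnvData.Cor218_iii_quotient T := by
  obtain ⟨R, h1, h2, -⟩ := RigidData.exists_rigidData_cor218_iii_quotient
  exact ⟨R.toThetaEnvData, h1, (R.cor218_iii_quotient_iff).1 h2⟩

end Literature.AnabelianGeometry.EtaleTheta

end
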